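import Summits.Ventures.QEC.Thresholds.ToricCodeThresholds
import Literature.Probability.RandomPlanarGeometry.SAWMemoryFourUpperBound
import HarnessLib

/-!
# Toric-code threshold: the memory-4 instance `ν = 26^{1/3}` (tier CERTIFIED, kernel-only input)

Venture QEC, `Summits/Ventures/QEC/Thresholds/` (director-qec D4″ instance list; companion of
`ToricCodeThresholds.lean`, whose table and HONEST FRAMING apply verbatim: everything here is
CONDITIONAL on the named fact `ToricCode.toricThreshold_of_sawCountBound`, hypothesis `h`).
Walk-count input, by IMPORT: the tree's kernel-checked memory-4 bound
`SAW.Zd.count_le_two_mul_mul_memFourConst_pow` (`c_{3m+1}(ℤ²) ≤ 4·26^m`,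
`Literature/Probability/RandomPlanarGeometry/SAWMemoryFourUpperBound.lean`; no `native_decide`),
completed to all lengths by `c_{n+2} ≤ 3 c_{n+1}` (`SAW.Zd.count_succ_succ_le`): `cₙ ≤ 2·(26^{1/3})^n`
(`sawCountBound_memoryFour`). Resulting threshold lower bound `p₀(26^{1/3}) ≈ .02935`
(`toricThreshold_memoryFour`, decimal certificate `thresholdValue_nuMemFour_gt : .0293 < p₀`),
improving the elementary `p₀(3) ≈ .02860` within the CERTIFIED tier. No Monte Carlo number here.

## References

* [DennisEtAl2002] Dennis–Kitaev–Landahl–Preskill, J. Math. Phys. 43 (2002) 4452, §5.3.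
* [BDGS2012] Bauerschmidt–Duminil-Copin–Goodman–Slade, *Lectures on self-avoiding walks*, §1.3.
-/

noncomputable section

namespace Summit.Ventures.QEC.Thresholds

open Filter Topology Finset
open Literature.InformationTheory.QuantumCodes
open Literature.InformationTheory.QuantumCodes.ToricCode
open Literature.Probability.RandomPlanarGeometry

/-! ### Instance 2 (tier CERTIFIED): the memory-4 count `c_{3m+1} ≤ 4·26^m`, `ν = 26^{1/3}` -/

/-- The memory-4 growth rate `26^{1/3} ≈ 2.9625` (`26 = (2d-1)³ - 1` at `d = 2`, the tree's
`memFourConst 2`). [cite: BDGS2012, §1.3 eq. (1.13) (improved by finite memory)] -/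
def nuMemFour : ℝ := (26 : ℝ) ^ ((1 : ℝ) / 3)

/-- `26^{1/3} > 0`. [folklore] -/
theorem nuMemFour_pos : 0 < nuMemFour := Real.rpow_pos_of_pos (by norm_num) _

/-- `(26^{1/3})³ = 26`. [folklore] -/
theorem nuMemFour_pow_three : nuMemFour ^ 3 = 26 := by
  unfold nuMemFour
  rw [← Real.rpow_natCast, ← Real.rpow_mul (by norm_num)]
  norm_num

/-- `2.9 ≤ 26^{1/3}` (since `2.9³ = 24.389 ≤ 26`). [folklore] -/
theorem nuMemFour_ge : (2.9 : ℝ) ≤ nuMemFour := by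
  by_contra hlt
  push Not at hlt
  have h3 : nuMemFour ^ 3 < 2.9 ^ 3 := pow_lt_pow_left₀ hlt nuMemFour_pos.le (by norm_num)
  rw [nuMemFour_pow_three] at h3
  norm_num at h3

/-- `26^{1/3} ≤ 2.964` (since `26 ≤ 2.964³ = 26.0399…`). [folklore] -/
theorem nuMemFour_le : nuMemFour ≤ 2.964 := by
  by_contra hlt
  push Not at hlt
  have h3 : (2.964 : ℝ) ^ 3 < nuMemFour ^ 3 := pow_lt_pow_left₀ hlt (by norm_num) (by norm_num)
  rw [nuMemFour_pow_three] at h3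
  norm_num at h3

/-- The memory-4 walk count in the hypothesis shape: `cₙ ≤ 2 · (26^{1/3})^n` for all `n` (from the
tree's kernel-checked `SAW.Zd.count_le_two_mul_mul_memFourConst_pow`: `c_{3m+1} ≤ 4·26^m`, and
`c_{n+2} ≤ 3 c_{n+1}` for the other residues). [cite: BDGS2012, §1.3 eq. (1.10) and (1.13)] -/
theorem sawCountBound_memoryFour : SAWCountBound 2 nuMemFour := by
  intro n
  rw [← SAW.Zd.count_two]
  have hM : Literature.Probability.Percolation.memFourConst 2 = 26 := by
    norm_num [Literature.Probability.Percolation.memFourConst]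
  -- the three kernel inputs, cast to `ℝ`
  have key1 : ∀ m : ℕ, (SAW.Zd.count 2 (3 * m + 1) : ℝ) ≤ 4 * 26 ^ m := fun m => by
    have h := SAW.Zd.count_le_two_mul_mul_memFourConst_pow (d := 2) le_rfl m
    rw [hM] at h
    have h' : (SAW.Zd.count 2 (3 * m + 1) : ℝ) ≤ ((2 * 2 * 26 ^ m : ℕ) : ℝ) := by exact_mod_cast h
    calc (SAW.Zd.count 2 (3 * m + 1) : ℝ) ≤ ((2 * 2 * 26 ^ m : ℕ) : ℝ) := h'
      _ = 4 * 26 ^ m := by push_cast; ring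
  have step : ∀ k : ℕ, (SAW.Zd.count 2 (k + 2) : ℝ) ≤ 3 * SAW.Zd.count 2 (k + 1) := fun k => by
    have h := SAW.Zd.count_succ_succ_le 2 k
    have h' : (SAW.Zd.count 2 (k + 2) : ℝ) ≤ (((2 * 2 - 1) * SAW.Zd.count 2 (k + 1) : ℕ) : ℝ) := by
      exact_mod_cast h
    calc (SAW.Zd.count 2 (k + 2) : ℝ) ≤ (((2 * 2 - 1) * SAW.Zd.count 2 (k + 1) : ℕ) : ℝ) := h'
      _ = 3 * SAW.Zd.count 2 (k + 1) := by push_cast; ring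
  have hν := nuMemFour_ge
  have hν0 := nuMemFour_pos
  have pow3 : ∀ m : ℕ, nuMemFour ^ (3 * m) = 26 ^ m := fun m => by
    rw [pow_mul, nuMemFour_pow_three]
  -- split `n = 3m + j`
  obtain ⟨m, j, hj, rfl⟩ : ∃ m j : ℕ, j < 3 ∧ n = 3 * m + j :=
    ⟨n / 3, n % 3, Nat.mod_lt _ (by norm_num), (Nat.div_add_mod n 3).symm⟩
  interval_cases j
  · -- `n = 3m`
    cases m with
    | zero =>
      have : SAW.Zd.count 2 (3 * 0 + 0) = 1 := by
        rw [SAW.Zd.count_two]; exact SAW.count_zero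
      rw [this]
      norm_num
    | succ k =>
      have e1 : 3 * (k + 1) + 0 = (3 * k + 1) + 2 := by ring
      have e2 : (3 * k + 1) + 1 = (3 * k) + 2 := by ring
      rw [e1]
      calc (SAW.Zd.count 2 (3 * k + 1 + 2) : ℝ) ≤ 3 * SAW.Zd.count 2 (3 * k + 1 + 1) := step _
        _ = 3 * SAW.Zd.count 2 (3 * k + 2) := by rw [e2]
        _ ≤ 3 * (3 * SAW.Zd.count 2 (3 * k + 1)) := by
            have := step (3 * k)
            have e3 : 3 * k + 2 = 3 * k + 2 := rfl
            nlinarith [this]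
        _ ≤ 3 * (3 * (4 * 26 ^ k)) := by nlinarith [key1 k]
        _ = 36 * 26 ^ k := by ring
        _ ≤ 52 * 26 ^ k := by nlinarith [pow_pos (by norm_num : (0 : ℝ) < 26) k]
        _ = 2 * nuMemFour ^ (3 * k + 1 + 2) := by
            have : 3 * k + 1 + 2 = 3 * (k + 1) := by ring
            rw [this, pow3 (k + 1), pow_succ]
            ring
  · -- `n = 3m + 1`
    calc (SAW.Zd.count 2 (3 * m + 1) : ℝ) ≤ 4 * 26 ^ m := key1 m
      _ ≤ 2 * nuMemFour * 26 ^ m := by nlinarith [pow_pos (by norm_num : (0 : ℝ) < 26) m]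
      _ = 2 * nuMemFour ^ (3 * m + 1) := by rw [pow_succ, pow3 m]; ring
  · -- `n = 3m + 2`
    have e2 : 3 * m + 2 = (3 * m) + 2 := rfl
    calc (SAW.Zd.count 2 (3 * m + 2) : ℝ) ≤ 3 * SAW.Zd.count 2 (3 * m + 1) := step (3 * m)
      _ ≤ 3 * (4 * 26 ^ m) := by nlinarith [key1 m]
      _ = 12 * 26 ^ m := by ring
      _ ≤ 2 * nuMemFour ^ 2 * 26 ^ m := by
          have : (6 : ℝ) ≤ nuMemFour ^ 2 := by nlinarith
          nlinarith [pow_pos (by norm_num : (0 : ℝ) < 26) m]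
      _ = 2 * nuMemFour ^ (3 * m + 2) := by rw [pow_add, pow3 m]; ring

/-- **Toric-code threshold, memory-4 instance (tier CERTIFIED, given `h`)**: for every
minimum-weight decoder family, `p₀(26^{1/3}) ≈ .02935` is a lower bound on the accuracy threshold.
CONDITIONAL on `toricThreshold_of_sawCountBound`. [cite: DennisEtAl2002, §5.3 eq. (threshold_2d)] -/
theorem toricThreshold_memoryFour (h : toricThreshold_of_sawCountBound)
    {D : (L : ℕ) → ZDecoder (L + 1)} (hD : ∀ L, (D L).IsMinWeight (syn (L + 1)) (cycles (L + 1)) hammingNorm) :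
    IsThresholdLowerBound (toricFailureFamily D) (thresholdValue nuMemFour) :=
  isThresholdLowerBound_of_sawCountBound h (le_trans (by norm_num) nuMemFour_ge)
    sawCountBound_memoryFour hD

/-- Decimal certificate: `.0293 < p₀(26^{1/3})` (via `26^{1/3} ≤ 2.964`).
[cite: DennisEtAl2002, §5.3 eq. (p_c_2d)] -/
theorem thresholdValue_nuMemFour_gt : (0.0293 : ℝ) < thresholdValue nuMemFour := by
  have hmono : thresholdValue 2.964 ≤ thresholdValue nuMemFour :=
    thresholdValue_antitone (le_trans (by norm_num) nuMemFour_ge) nuMemFour_le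
  refine lt_of_lt_of_le ?_ hmono
  unfold thresholdValue
  have : Real.sqrt (1 - 1 / (2.964 : ℝ) ^ 2) < 0.9414 := by
    rw [Real.sqrt_lt' (by norm_num)]
    norm_num
  linarith

end Summit.Ventures.QEC.Thresholds

end
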